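import Literature.Probability.RandomPlanarGeometry.ArcHullDomains
import Literature.Probability.RandomPlanarGeometry.HullApproximationProofs
import Literature.Probability.RandomPlanarGeometry.CaratheodoryHalfPlaneProofs
import Literature.Probability.RandomPlanarGeometry.ConformalMapCaratheodoryProofs
import Literature.Probability.RandomPlanarGeometry.HullRestrictionTests
import Literature.Topology.PlaneTopology.JordanCurveProofs
import Summits.CriticalPhenomena.SAWScalingLimit.Theses.SAWLoopFugacityFlow
import HarnessLib

/-!
# Boundary clause of the SHAPE stub — stub `stub_rangeIsArc_boundary`
(line `marked-point-revisit`, crux `SAWLoopFugacityFlow.SimpleSubseqLimits`, stmt-CriticalPhenomena-4982)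

Sub-stub 2 of the SHAPE stub `stub_rangeIsArc` (plan `RangeIsArc-PLAN.md`, paragraph (B)). Let
`(D; a, b)` be a Dobrushin domain, `μ` a probability measure on curve classes carried by traces
in `cl D` meeting `∂D` only inside `{a, b}`, and `ν` a probability measure giving the same mass
as `μ` to `{range ⊆ cl D'}` for every subdomain `D' ⊆ D` with the marked points `a, b` which
agrees with `D` near `a` and `b` (`AvoidanceAgree`). Then `ν`-a.e. trace meets `∂D` only inside
`{a, b}`.

Proof. Fix a chordal uniformizing map `φ : (ℍ; 0, ∞) → (D; a, b)` and its Carathéodory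
extension `φ̄` (`φ̄(ℝ) = ∂D ∖ {b}`, `φ̄(0) = a`). For a real segment `[q₁, q₂] ∌ 0` let
`C = φ̄([q₁, q₂])` and let `B_ρ` (`ρ ↑ 1`) be the closed half-ellipses with foci `q₁, q₂`
(`ellHull`, reflected through the imaginary axis on the negative side): smooth `*`-hulls
(`IsArcHull`, PROVED here) shrinking to a real segment `S₀ ∌ 0`, with `[q₁, q₂]` interior to
`B_ρ ∪ {Im < 0}`. The Jordan hull subdomain `D_ρ = φ(ℍ ∖ B_ρ)` (`exists_isHullSubdomain_of_isArcHull`)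
is admissible for `AvoidanceAgree`; its closure misses `C` (closure points of `φ(ℍ ∖ B_ρ)` at
`φ̄(x)` pull back to closure points of `ℍ ∖ B_ρ` at `x`, boundary behaviour of `φ⁻¹`); and a
`μ`-typical trace — a compact subset of `D ∪ {a, b}`, at positive distance from the compact set
`F = φ̄(S₀) ⊆ ∂D ∖ {a, b}` — lies in `cl D_ρ` once `φ(B_ρ ∩ ℍ)` is within that distance of `F`
(continuity of `φ̄` on `ℍ̄`, compactness of the `B_ρ`). Hence
`ν{range ∩ C = ∅} ≥ sup_ρ ν{range ⊆ cl D_ρ} = sup_ρ μ{range ⊆ cl D_ρ} = 1`; countably many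
rational segments cover `ℝ ∖ {0}`.
-/

noncomputable section

open MeasureTheory Filter Topology Set Metric
open Literature.Probability.RandomPlanarGeometry Literature.Probability.LatticeModels
open UpperHalfPlane (upperHalfPlaneSet isOpen_upperHalfPlaneSet)
open scoped ENNReal NNReal BoundedContinuousFunction unitInterval

namespace Summit.CriticalPhenomena.SAWScalingLimit.Theorems.SimpleSubseqLimits.MarkedPointRevisit.ArcRangeBoundary

/-- **Hull-avoidance agreement** of two measures on curve classes: `ν` and `μ` give the same mass
to `{range ⊆ closure D'}` for every Dobrushin subdomain `D' ⊆ D` with the same marked points that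
agrees with `D` in balls around them (the inline hull-subdomain condition of the route items
`AvoidanceLimit` / `AvoidancePassage` / `SLEAvoidanceValue` / `AvoidanceDeterminesLaw`). Verbatim
the vocabulary of the registered skeleton `Cruxes/SimpleSubseqLimits/Lines/marked-point-revisit.lean`
(line marked-point-revisit of crux stmt-CriticalPhenomena-4982), kept in the sub-namespace
`…MarkedPointRevisit.ArcRangeBoundary`; the two agree by `Iff.rfl`. [folklore] -/
def AvoidanceAgree (D : DobrushinDomain) (ν μ : Measure (CurveClass ℂ)) : Prop :=
  ∀ D' : DobrushinDomain, D'.carrier ⊆ D.carrier → D'.pt 0 = D.pt 0 → D'.pt 1 = D.pt 1 →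
    (∃ ε : ℝ, 0 < ε ∧ D'.carrier ∩ ball (D.pt 0) ε = D.carrier ∩ ball (D.pt 0) ε ∧
      D'.carrier ∩ ball (D.pt 1) ε = D.carrier ∩ ball (D.pt 1) ε) →
    ν (CurveClass.rangeSubset (closure D'.carrier)) =
      μ (CurveClass.rangeSubset (closure D'.carrier))

/-! ### Half-ellipse hulls: smooth hulls shrinking to a real segment -/

/-- **The half-ellipse hull `B(a,b;ρ)` is a smooth hull**: in `ℍ` it agrees with the full
ellipse, whose frontier there is the open upper arc `ellHullArc(0,1)`. [folklore] -/
theorem isArcHull_ellHull {a b ρ : ℝ} (hab : a < b) (h0 : 0 < ρ) (h1 : ρ < 1)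
    (hB : ellH a b * jLevel ρ < ellC a b) : IsArcHull (ellHull a b ρ) := by
  refine ⟨(isStarHull_ellHull hab h0 h1 hB).isBoundedHull, ellHullArc a b ρ,
    (continuous_ellHullArc a b h0).continuousOn, injOn_ellHullArc hab h0,
    ellHullArc_im_eq_zero a b h0 (Or.inl rfl), ellHullArc_im_eq_zero a b h0 (Or.inr rfl),
    fun t ht ↦ ellHullArc_im_pos hab h0 h1 ht, ?_⟩
  have h : ellHull a b ρ ∩ upperHalfPlaneSet = ellRegion a b ρ ∩ upperHalfPlaneSet := by
    ext z
    simp only [ellHull, mem_inter_iff, mem_setOf_eq]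
    exact ⟨fun h ↦ ⟨h.1.1, h.2⟩, fun h ↦ ⟨⟨h.1, le_of_lt (show (0 : ℝ) < z.im from h.2)⟩, h.2⟩⟩
  rw [inter_comm, frontier_inter_eq_of_inter_eq isOpen_upperHalfPlaneSet h, inter_comm]
  exact upperHalfPlaneSet_inter_frontier_ellRegion hab h0 h1

/-- The focal segment `[a, b]` is interior to `B(a,b;ρ) ∪ {Im < 0}`: no point of it is in the
closure of `ℍ ∖ B(a,b;ρ)`. [folklore] -/
theorem ofReal_notMem_closure_diff_ellHull {a b ρ : ℝ} (hab : a < b) (h0 : 0 < ρ) (h1 : ρ < 1)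
    {x : ℝ} (hx : x ∈ Icc a b) : (x : ℂ) ∉ closure (upperHalfPlaneSet \ ellHull a b ρ) := by
  have hδ : 0 < ellH a b * (jLevel ρ - 2) :=
    mul_pos (ellH_pos hab) (by linarith [two_lt_jLevel h0 h1])
  rw [mem_closure_iff_nhds]
  intro h
  obtain ⟨w, hw, hwH, hwB⟩ := h _ (ball_mem_nhds _ hδ)
  refine hwB ⟨mem_ellRegion_of_infDist_lt hab le_rfl ?_, le_of_lt (show (0 : ℝ) < w.im from hwH)⟩
  exact (infDist_le_dist_of_mem (ofReal_mem_realSeg.2 (Icc_subset_uIcc hx))).trans_lt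
    (mem_ball.1 hw)

/-- For `0 < a < b` there is a radius `ρ₀ ∈ (0, 1)` with `h(ρ₀ + ρ₀⁻¹) < c`, i.e. all real points
of `B(a,b;ρ₀)` are positive (`ρ + ρ⁻¹ → 2`, `c - 2h = a > 0`). [folklore] -/
theorem exists_rho {a b : ℝ} (ha : 0 < a) (hab : a < b) :
    ∃ ρ₀ : ℝ, 0 < ρ₀ ∧ ρ₀ < 1 ∧ ellH a b * jLevel ρ₀ < ellC a b := by
  have hh := ellH_pos hab
  have hlt : (2 : ℝ) < ellC a b / ellH a b := by
    rw [lt_div_iff₀ hh]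
    have := left_eq_ellC_sub a b
    linarith
  have hev1 : ∀ᶠ ρ in 𝓝[<] (1 : ℝ), jLevel ρ < ellC a b / ellH a b :=
    nhdsWithin_le_nhds (tendsto_jLevel_one (Iio_mem_nhds hlt))
  have hev2 : ∀ᶠ ρ in 𝓝[<] (1 : ℝ), 0 < ρ := nhdsWithin_le_nhds (Ioi_mem_nhds one_pos)
  obtain ⟨ρ, h1, h2, h3⟩ := (hev1.and (hev2.and self_mem_nhdsWithin)).exists
  exact ⟨ρ, h2, h3, by rwa [lt_div_iff₀ hh, mul_comm] at h1⟩

/-- **The half-ellipse hulls shrink to a real segment**: every open set containing the real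
segment `[c - h(ρ₀ + ρ₀⁻¹), c + h(ρ₀ + ρ₀⁻¹)]` contains some `B(a,b;ρ)`, `ρ ∈ [ρ₀, 1)`
(compactness: the nested compact sets `B(a,b;ρ)` have no common point in `ℍ`). [folklore] -/
theorem exists_ellHull_subset {a b ρ₀ : ℝ} (hab : a < b) (h0 : 0 < ρ₀) (h1 : ρ₀ < 1)
    {O : Set ℂ} (hO : IsOpen O) (hsub : ∀ x : ℝ, ellC a b - ellH a b * jLevel ρ₀ ≤ x →
      x ≤ ellC a b + ellH a b * jLevel ρ₀ → (x : ℂ) ∈ O) :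
    ∃ ρ, ρ₀ ≤ ρ ∧ ρ < 1 ∧ ellHull a b ρ ⊆ O := by
  haveI : Nonempty (Ico ρ₀ 1) := ⟨⟨ρ₀, le_rfl, h1⟩⟩
  set t : Ico ρ₀ 1 → Set ℂ := fun ρ ↦ ellHull a b ρ with ht
  have hK : IsCompact (ellHull a b ρ₀ \ O) :=
    (isCompact_of_isClosed_isBounded (isClosed_ellHull a b ρ₀) (isBounded_ellHull hab ρ₀)).diff hO
  have hst : (ellHull a b ρ₀ \ O) ∩ ⋂ i, t i = ∅ := by
    refine eq_empty_of_forall_notMem fun z hz ↦ ?_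
    obtain ⟨⟨hz0, hzO⟩, hzt⟩ := hz
    rw [mem_iInter] at hzt
    rcases (show 0 ≤ z.im from hz0.2).lt_or_eq with hpos | him
    · obtain ⟨ρ, hρn, hρ0, hρ1⟩ :=
        ((eventually_notMem_ellRegion hab hpos).and (Ioo_mem_nhdsLT h1)).exists
      exact hρn (hzt ⟨ρ, hρ0.le, hρ1⟩).1
    · apply hzO
      have hzre : ((z.re : ℝ) : ℂ) = z := Complex.ext (by simp) (by simp [him])
      obtain ⟨hl, hr⟩ := ofReal_mem_ellRegion hab (x := z.re) (by rw [hzre]; exact hz0.1)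
      rw [← hzre]
      exact hsub _ hl hr
  have hdt : Directed (· ⊇ ·) t := by
    rintro ⟨r, hr0, hr1⟩ ⟨s, hs0, hs1⟩
    exact ⟨⟨max r s, le_max_of_le_left hr0, max_lt hr1 hs1⟩,
      ellHull_mono (h0.trans_le hr0) (le_max_left r s) (max_lt hr1 hs1).le,
      ellHull_mono (h0.trans_le hs0) (le_max_right r s) (max_lt hr1 hs1).le⟩
  obtain ⟨⟨ρ, hρ0, hρ1⟩, hρ⟩ :=
    hK.elim_directed_family_closed t (fun ρ ↦ isClosed_ellHull a b ρ) hst hdt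
  refine ⟨ρ, hρ0, hρ1, fun z hz ↦ ?_⟩
  by_contra hzO
  exact (eq_empty_iff_forall_notMem.1 hρ z) ⟨⟨ellHull_mono h0 hρ0 hρ1.le hz, hzO⟩, hz⟩

/-- **Thin smooth hulls around a positive segment.** For `0 < q₁ < q₂` there is a compact real
set `S₀ ∌ 0` such that every open set containing `S₀` contains a smooth `*`-hull `J` with
`[q₁, q₂]` off the closure of `ℍ ∖ J` (the half-ellipses with foci `q₁, q₂`). [folklore] -/
theorem exists_hulls_pos {q₁ q₂ : ℝ} (hq : q₁ < q₂) (h0 : 0 < q₁) :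
    ∃ S₀ : Set ℝ, IsCompact S₀ ∧ (0 : ℝ) ∉ S₀ ∧ ∀ O : Set ℂ, IsOpen O →
      (∀ x ∈ S₀, (x : ℂ) ∈ O) → ∃ J : Set ℂ, IsArcHull J ∧ (0 : ℂ) ∉ J ∧ J ⊆ O ∧
        ∀ x ∈ Icc q₁ q₂, (x : ℂ) ∉ closure (upperHalfPlaneSet \ J) := by
  obtain ⟨ρ₀, h0', h1, hB⟩ := exists_rho h0 hq
  refine ⟨Icc (ellC q₁ q₂ - ellH q₁ q₂ * jLevel ρ₀) (ellC q₁ q₂ + ellH q₁ q₂ * jLevel ρ₀),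
    isCompact_Icc, fun h ↦ by linarith [h.1], fun O hO hS ↦ ?_⟩
  obtain ⟨ρ, hρ0, hρ1, hρO⟩ := exists_ellHull_subset hq h0' h1 hO fun x hl hr ↦ hS x ⟨hl, hr⟩
  have hρ : 0 < ρ := h0'.trans_le hρ0
  have hBρ : ellH q₁ q₂ * jLevel ρ < ellC q₁ q₂ :=
    (mul_le_mul_of_nonneg_left (jLevel_le_jLevel h0' hρ0 hρ1.le) (ellH_pos hq).le).trans_lt hB
  exact ⟨ellHull q₁ q₂ ρ, isArcHull_ellHull hq hρ hρ1 hBρ, (isStarHull_ellHull hq hρ hρ1 hBρ).2,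
    hρO, fun x hx ↦ ofReal_notMem_closure_diff_ellHull hq hρ hρ1 hx⟩

/-- **Thin smooth hulls around a segment off the origin** (`exists_hulls_pos`, and its
reflection through the imaginary axis `σ(z) = -z̄` on the negative side). [folklore] -/
theorem exists_hulls {q₁ q₂ : ℝ} (hq : q₁ < q₂) (h0 : 0 < q₁ ∨ q₂ < 0) :
    ∃ S₀ : Set ℝ, IsCompact S₀ ∧ (0 : ℝ) ∉ S₀ ∧ ∀ O : Set ℂ, IsOpen O →
      (∀ x ∈ S₀, (x : ℂ) ∈ O) → ∃ J : Set ℂ, IsArcHull J ∧ (0 : ℂ) ∉ J ∧ J ⊆ O ∧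
        ∀ x ∈ Icc q₁ q₂, (x : ℂ) ∉ closure (upperHalfPlaneSet \ J) := by
  rcases h0 with h0 | h0
  · exact exists_hulls_pos hq h0
  obtain ⟨S₀, hS₀c, hS₀0, hfam⟩ := exists_hulls_pos (neg_lt_neg hq) (neg_pos.2 h0)
  refine ⟨(fun x ↦ -x) '' S₀, hS₀c.image continuous_neg, ?_, fun O hO hS ↦ ?_⟩
  · rintro ⟨x, hx, hx0⟩
    exact hS₀0 (by rwa [neg_eq_zero.1 hx0] at hx)
  obtain ⟨J, hJ, hJ0, hJO, hJcl⟩ := hfam (imagAxisRefl '' O) (imagAxisRefl.isOpenMap O hO)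
    fun x hx ↦ ⟨((-x : ℝ) : ℂ), hS (-x) ⟨x, hx, rfl⟩, by rw [imagAxisRefl_ofReal, neg_neg]⟩
  refine ⟨imagAxisRefl '' J, hJ.image_imagAxisRefl, ?_, ?_, fun x hx hxcl ↦ ?_⟩
  · rintro ⟨z, hz, hz0⟩
    have : z = 0 := by simpa using congrArg imagAxisRefl hz0
    exact hJ0 (this ▸ hz)
  · rintro _ ⟨z, hz, rfl⟩
    obtain ⟨w, hw, hwz⟩ := hJO hz
    rwa [← hwz, imagAxisRefl_imagAxisRefl]
  · rw [← imagAxisRefl_image_diff, ← imagAxisRefl.image_closure] at hxcl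
    obtain ⟨w, hw, hwx⟩ := hxcl
    have : w = ((-x : ℝ) : ℂ) := by
      rw [← imagAxisRefl_imagAxisRefl w, hwx, imagAxisRefl_ofReal]
    exact hJcl (-x) ⟨by linarith [hx.2], by linarith [hx.1]⟩ (this ▸ hw)

/-! ### Two facts on Dobrushin domains -/

/-- **Closure points pull back along a uniformizing map**: if `φ̄(x)` (`x` real) is in the
closure of `φ(W)`, `W ⊆ ℍ`, then `x` is in the closure of `W` — `φ⁻¹ w → x` as `w → φ̄(x)`
within `D` (Carathéodory). [folklore] -/
theorem ofReal_mem_closure_of_mem_closure_image {D : JordanDomain}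
    {φ : ConformalEquiv upperHalfPlaneSet D.carrier} {Φ : ℂ → ℂ} (hΦ : D.IsDiscExtension φ Φ)
    {W : Set ℂ} (hW : W ⊆ upperHalfPlaneSet) {x : ℝ}
    (hx : φ.boundaryExtension x ∈ closure (φ '' W)) : (x : ℂ) ∈ closure W := by
  have ht : Tendsto φ.symm (𝓝[D.carrier] (φ.boundaryExtension x)) (𝓝 (x : ℂ)) :=
    JordanDomain.tendsto_symm_nhds φ hΦ.continuousOn hΦ.eqOn hΦ.bijOn.injOn
      (hΦ.tendsto_nhdsWithin (z := x) (by simp))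
  have hsub : φ '' W ⊆ D.carrier := by rintro _ ⟨w, hw, rfl⟩; exact φ.mapsTo (hW hw)
  haveI : (𝓝[φ '' W] (φ.boundaryExtension x)).NeBot := mem_closure_iff_nhdsWithin_neBot.1 hx
  refine mem_closure_of_tendsto (ht.mono_left (nhdsWithin_mono _ hsub)) ?_
  filter_upwards [self_mem_nhdsWithin]
  rintro _ ⟨w, hw, rfl⟩
  rwa [φ.symm_apply_apply (hW hw)]

/-- **A hull subdomain agrees with the domain in balls around the marked points** (the inline
admissibility condition of `AvoidanceAgree`): `a, b ∉ cl(D ∖ D')`. [folklore] -/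
theorem exists_ball_inter_eq {D D' : DobrushinDomain} (h : D.IsHullSubdomain D') :
    ∃ ε : ℝ, 0 < ε ∧ D'.carrier ∩ ball (D.pt 0) ε = D.carrier ∩ ball (D.pt 0) ε ∧
      D'.carrier ∩ ball (D.pt 1) ε = D.carrier ∩ ball (D.pt 1) ε := by
  have key : ∀ i : Fin 2, ∃ ε > 0, ∀ δ, δ ≤ ε →
      D'.carrier ∩ ball (D.pt i) δ = D.carrier ∩ ball (D.pt i) δ := by
    intro i
    obtain ⟨ε, hε, hball⟩ := Metric.eventually_nhds_iff_ball.1 (h.eventually_mem i)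
    exact ⟨ε, hε, fun δ hδ ↦ Set.ext fun z ↦ ⟨fun hz ↦ ⟨h.1 hz.1, hz.2⟩,
      fun hz ↦ ⟨hball z (ball_subset_ball hδ hz.2) hz.1, hz.2⟩⟩⟩
  obtain ⟨ε₀, hε₀, h₀⟩ := key 0
  obtain ⟨ε₁, hε₁, h₁⟩ := key 1
  exact ⟨min ε₀ ε₁, lt_min hε₀ hε₁, h₀ _ (min_le_left _ _), h₁ _ (min_le_right _ _)⟩

/-! ### One boundary arc is avoided almost surely -/

/-- **`ν`-a.e. trace misses the boundary arc `φ̄([q₁, q₂])`** (`[q₁, q₂] ∌ 0`): the sandwich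
`ν{range ∩ φ̄[q₁,q₂] = ∅} ≥ ν{range ⊆ cl D_J} = μ{range ⊆ cl D_J} ≥ μ{range off a neighbourhood
of F}` over the hull subdomains `D_J = φ(ℍ ∖ J)` of the thin smooth hulls `J` of `exists_hulls`,
`F = φ̄(S₀) ⊆ ∂D ∖ {a, b}`, and continuity of `μ` from below. [folklore] -/
theorem ae_disjoint_image_Icc {D : DobrushinDomain} {ν μ : Measure (CurveClass ℂ)}
    [IsProbabilityMeasure ν] [IsProbabilityMeasure μ]
    (hμ : ∀ᵐ γ ∂μ, γ.range ⊆ closure D.carrier ∧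
      γ.range ∩ frontier D.carrier ⊆ {D.pt 0, D.pt 1})
    (hA : AvoidanceAgree D ν μ) {φ : ConformalEquiv upperHalfPlaneSet D.carrier}
    (hφ : D.IsChordalUniformizing φ) {Φ : ℂ → ℂ}
    (hΦ : JordanDomain.IsDiscExtension D.toJordanDomain φ Φ) {q₁ q₂ : ℝ} (hq : q₁ < q₂)
    (h0 : 0 < q₁ ∨ q₂ < 0) :
    ∀ᵐ c ∂ν, Disjoint c.range (φ.boundaryExtension '' ((fun x : ℝ ↦ (x : ℂ)) '' Icc q₁ q₂)) := by
  have hC := JordanDomain.exists_continuousOn_extension_holds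
  obtain ⟨S₀, hS₀c, hS₀0, hfam⟩ := exists_hulls hq h0
  set C : Set ℂ := φ.boundaryExtension '' ((fun x : ℝ ↦ (x : ℂ)) '' Icc q₁ q₂) with hCdef
  set F : Set ℂ := φ.boundaryExtension '' ((fun x : ℝ ↦ (x : ℂ)) '' S₀) with hFdef
  have hreal : ∀ T : Set ℝ, (fun x : ℝ ↦ (x : ℂ)) '' T ⊆ closure upperHalfPlaneSet := by
    rintro T _ ⟨x, -, rfl⟩
    exact mem_closure_upperHalfPlaneSet_iff.2 (by simp)
  have hCc : IsClosed C := (MarkedDomain.isCompact_image_boundaryExtension hC (hreal _)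
    (isCompact_Icc.image Complex.continuous_ofReal)).isClosed
  have hFc : IsCompact F := MarkedDomain.isCompact_image_boundaryExtension hC (hreal _)
    (hS₀c.image Complex.continuous_ofReal)
  have hFfr : F ⊆ frontier D.carrier := by
    rintro _ ⟨_, ⟨x, -, rfl⟩, rfl⟩
    exact hΦ.boundaryExtension_ofReal_mem_frontier x
  have hFpt : ∀ i, D.pt i ∉ F := fun i ↦
    MarkedDomain.pt_notMem_image_boundaryExtension hC hφ (hreal _) (by
      rintro ⟨x, hx, hx0⟩
      exact hS₀0 (by rwa [Complex.ofReal_eq_zero.1 hx0] at hx)) i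
  -- the increasing events "the trace is off the `1/(m+1)`-neighbourhood of `F`"
  set G : ℕ → Set (CurveClass ℂ) :=
    fun m ↦ CurveClass.rangeSubset (thickening (1 / ((m : ℝ) + 1)) F)ᶜ with hGdef
  have hGmem : ∀ m c, c ∈ G m ↔ c.range ⊆ (thickening (1 / ((m : ℝ) + 1)) F)ᶜ :=
    fun m c ↦ Iff.rfl
  have hGmono : Monotone G := by
    intro m n hmn c hc
    rw [hGmem] at hc ⊢
    intro z hz h
    refine hc hz (thickening_mono ?_ F h)
    gcongr
  have hGae : ∀ᵐ γ ∂μ, γ ∈ ⋃ m, G m := by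
    filter_upwards [hμ] with γ hγ
    have hdisj : Disjoint γ.range F := by
      refine Set.disjoint_left.2 fun z hz hzF ↦ ?_
      rcases hγ.2 ⟨hz, hFfr hzF⟩ with h | h
      · exact hFpt 0 (h ▸ hzF)
      · exact hFpt 1 ((mem_singleton_iff.1 h) ▸ hzF)
    obtain ⟨δ, hδ, hδd⟩ := hdisj.exists_cthickenings γ.isCompact_range hFc.isClosed
    obtain ⟨m, hm⟩ := exists_nat_one_div_lt hδ
    refine mem_iUnion.2 ⟨m, (hGmem m γ).2 fun z hz hzU ↦ ?_⟩
    exact Set.disjoint_left.1 hδd (self_subset_cthickening _ hz)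
      (cthickening_mono hm.le F (thickening_subset_cthickening _ F hzU))
  have hμG : μ (⋃ m, G m) = 1 := by
    have hmeas : MeasurableSet (⋃ m, G m) := MeasurableSet.iUnion fun m ↦
      (CurveClass.isClosed_rangeSubset isOpen_thickening.isClosed_compl).measurableSet
    rw [← prob_compl_eq_zero_iff hmeas]
    exact ae_iff.1 hGae
  have hcont : ContinuousOn φ.boundaryExtension (closure upperHalfPlaneSet) :=
    JordanDomain.continuousOn_boundaryExtension_holds D.toJordanDomain φ
  -- the sandwich, one hull subdomain for each `m`
  have key : ∀ m, μ (G m) ≤ ν (CurveClass.rangeSubset Cᶜ) := by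
    intro m
    obtain ⟨u, hu, hueq⟩ :=
      (_root_.continuousOn_iff'.1 hcont) (thickening (1 / ((m : ℝ) + 1)) F) isOpen_thickening
    have hS₀u : ∀ x ∈ S₀, (x : ℂ) ∈ u := by
      intro x hx
      have : (x : ℂ) ∈ φ.boundaryExtension ⁻¹' thickening (1 / ((m : ℝ) + 1)) F ∩
          closure upperHalfPlaneSet :=
        ⟨self_subset_thickening (by positivity) F ⟨x, ⟨x, hx, rfl⟩, rfl⟩, hreal _ ⟨x, hx, rfl⟩⟩
      rw [hueq] at this
      exact this.1
    obtain ⟨J, hJ, hJ0, hJu, hJcl⟩ := hfam u hu hS₀u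
    obtain ⟨D', hD', hcar⟩ := exists_isHullSubdomain_of_isArcHull
      Literature.Topology.PlaneTopology.JordanCurveTheorem_holds hC hφ hJ hJ0
    have hagree := hA D' hD'.1 hD'.2.1 hD'.2.2.1 (exists_ball_inter_eq hD')
    -- `ν`-side: the closure of `D'` misses `C`
    have hνside : CurveClass.rangeSubset (closure D'.carrier) ⊆ CurveClass.rangeSubset Cᶜ := by
      intro c hc
      rw [CurveClass.mem_rangeSubset] at hc ⊢
      rintro z hz ⟨_, ⟨x, hx, rfl⟩, hxz⟩
      have hcl : φ.boundaryExtension x ∈ closure (φ '' (upperHalfPlaneSet \ J)) := by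
        rw [hxz, ← hcar]
        exact hc hz
      exact hJcl x hx (ofReal_mem_closure_of_mem_closure_image hΦ Set.sdiff_subset hcl)
    -- `μ`-side: a typical trace off the neighbourhood of `F` lies in `cl D'`
    have hμside : ∀ᵐ γ ∂μ, γ ∈ G m → γ ∈ CurveClass.rangeSubset (closure D'.carrier) := by
      filter_upwards [hμ] with γ hγ hG
      rw [hGmem] at hG
      rw [CurveClass.mem_rangeSubset]
      intro z hz
      by_cases hzD : z ∈ D.carrier
      · have hw : φ.symm z ∈ upperHalfPlaneSet := φ.symm_mapsTo hzD
        have hwJ : φ.symm z ∉ J := by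
          intro hwJ
          refine hG hz ?_
          have h1 : φ.symm z ∈ φ.boundaryExtension ⁻¹' thickening (1 / ((m : ℝ) + 1)) F ∩
              closure upperHalfPlaneSet := by
            rw [hueq]
            exact ⟨hJu hwJ, subset_closure hw⟩
          simpa only [mem_preimage, φ.boundaryExtension_eq hw, φ.apply_symm_apply hzD] using h1.1
        exact subset_closure (hcar ▸ ⟨φ.symm z, ⟨hw, hwJ⟩, φ.apply_symm_apply hzD⟩)
      · have hzfr : z ∈ frontier D.carrier := ⟨hγ.1 hz, by rwa [D.isOpen.interior_eq]⟩
        rcases hγ.2 ⟨hz, hzfr⟩ with h | h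
        · rw [h, ← hD'.2.1]
          exact frontier_subset_closure (D'.pt_mem_frontier 0)
        · rw [mem_singleton_iff.1 h, ← hD'.2.2.1]
          exact frontier_subset_closure (D'.pt_mem_frontier 1)
    calc μ (G m) ≤ μ (CurveClass.rangeSubset (closure D'.carrier)) := measure_mono_ae hμside
      _ = ν (CurveClass.rangeSubset (closure D'.carrier)) := hagree.symm
      _ ≤ ν (CurveClass.rangeSubset Cᶜ) := measure_mono hνside
  have hone : ν (CurveClass.rangeSubset Cᶜ) = 1 := by
    refine le_antisymm prob_le_one ?_
    rw [← hμG, hGmono.measure_iUnion]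
    exact iSup_le key
  have hmeasC : MeasurableSet (CurveClass.rangeSubset Cᶜ) :=
    (CurveClass.isOpen_rangeSubset hCc.isOpen_compl).measurableSet
  have hae : ∀ᵐ c ∂ν, c ∈ CurveClass.rangeSubset Cᶜ := by
    rw [ae_iff]
    exact (prob_compl_eq_zero_iff hmeasC).2 hone
  exact hae.mono fun c hc ↦ subset_compl_iff_disjoint_right.1 hc

/-! ### The stub -/

/-- **Stub `stub_rangeIsArc_boundary` of the line `marked-point-revisit` — the boundary clause.**
If `μ` (probability, carried by simple chords of `(D; a, b)` in `cl D` touching `∂D` only at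
`a, b`) and `ν` (probability) give the same mass to `{range ⊆ cl D'}` for all admissible
subdomains `D'` (`AvoidanceAgree`), then `ν`-a.e. trace meets `∂D` only inside `{a, b}`:
countably many arcs `φ̄([q₁, q₂])`, `q₁ < q₂` rational of the same sign, cover `∂D ∖ {a, b}`
(Carathéodory: `∂D ∖ {b} = φ̄(ℝ)`, `φ̄(0) = a`), and each is avoided a.s.
(`ae_disjoint_image_Icc`). [folklore] -/
theorem stub_rangeIsArc_boundary :
    ∀ (D : DobrushinDomain) (ν μ : Measure (CurveClass ℂ)), IsProbabilityMeasure ν →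
      IsProbabilityMeasure μ →
      (∀ᵐ c ∂ν, c.source = D.pt 0 ∧ c.target = D.pt 1 ∧ c.range ⊆ closure D.carrier) →
      (∀ᵐ γ ∂μ, γ ∈ CurveClass.simple ∧ γ.source = D.pt 0 ∧ γ.target = D.pt 1 ∧
        γ.range ⊆ closure D.carrier ∧ γ.range ∩ frontier D.carrier ⊆ {D.pt 0, D.pt 1}) →
      AvoidanceAgree D ν μ → ∀ᵐ c ∂ν, c.range ∩ frontier D.carrier ⊆ {D.pt 0, D.pt 1} := by
  intro D ν μ hν hμp _ hμ hA
  have hC := JordanDomain.exists_continuousOn_extension_holds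
  obtain ⟨φ, hφ⟩ := MarkedDomain.exists_isChordalUniformizing_holds D
  obtain ⟨Φ, hΦ⟩ := JordanDomain.exists_isDiscExtension hC φ
  have hμ' : ∀ᵐ γ ∂μ, γ.range ⊆ closure D.carrier ∧
      γ.range ∩ frontier D.carrier ⊆ {D.pt 0, D.pt 1} :=
    hμ.mono fun γ h ↦ ⟨h.2.2.2.1, h.2.2.2.2⟩
  have hall : ∀ᵐ c ∂ν, ∀ q : ℚ × ℚ, (q.1 : ℝ) < q.2 → (0 < (q.1 : ℝ) ∨ (q.2 : ℝ) < 0) →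
      Disjoint c.range (φ.boundaryExtension '' ((fun x : ℝ ↦ (x : ℂ)) '' Icc (q.1 : ℝ) q.2)) := by
    rw [ae_all_iff]
    intro q
    by_cases h : (q.1 : ℝ) < q.2 ∧ (0 < (q.1 : ℝ) ∨ (q.2 : ℝ) < 0)
    · exact (ae_disjoint_image_Icc hμ' hA hφ hΦ h.1 h.2).mono fun c hc _ _ ↦ hc
    · exact ae_of_all _ fun c h1 h2 ↦ absurd ⟨h1, h2⟩ h
  filter_upwards [hall] with c hc
  rintro p ⟨hp, hpfr⟩
  by_contra hpab
  simp only [mem_insert_iff, mem_singleton_iff, not_or] at hpab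
  -- `p = φ̄ x` for a real `x ≠ 0`
  obtain ⟨t, -, ht⟩ := D.toJordanDomain.exists_mem_Ico_boundary_eq hpfr 0
  have hne : D.boundary t ≠ Φ 1 := by
    rw [ht, hΦ.apply_one_eq hφ.2]
    exact hpab.2
  set x : ℝ := D.toJordanDomain.discParam Φ t with hxdef
  have hx : φ.boundaryExtension x = p := (hΦ.boundaryExtension_discParam hne).trans ht
  have hx0 : x ≠ 0 := fun h ↦ hpab.1 (by rw [← hx, h, Complex.ofReal_zero, hφ.boundaryExtension_zero])
  -- rationals of the sign of `x` around `x`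
  obtain ⟨q₁, q₂, hq, hsign, hxq⟩ : ∃ q₁ q₂ : ℚ, (q₁ : ℝ) < q₂ ∧ (0 < (q₁ : ℝ) ∨ (q₂ : ℝ) < 0) ∧
      x ∈ Icc (q₁ : ℝ) q₂ := by
    rcases hx0.lt_or_gt with hneg | hpos
    · obtain ⟨q₁, hq₁⟩ := exists_rat_lt x
      obtain ⟨q₂, hxq₂, hq₂⟩ := exists_rat_btwn hneg
      exact ⟨q₁, q₂, hq₁.trans hxq₂, Or.inr hq₂, hq₁.le, hxq₂.le⟩
    · obtain ⟨q₁, hq₁, hq₁x⟩ := exists_rat_btwn hpos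
      obtain ⟨q₂, hq₂⟩ := exists_rat_gt x
      exact ⟨q₁, q₂, hq₁x.trans hq₂, Or.inl hq₁, hq₁x.le, hq₂.le⟩
  exact Set.disjoint_left.1 (hc (q₁, q₂) hq hsign) hp ⟨x, ⟨x, hxq, rfl⟩, hx⟩

end Summit.CriticalPhenomena.SAWScalingLimit.Theorems.SimpleSubseqLimits.MarkedPointRevisit.ArcRangeBoundary

end
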